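import Summits.QuantumFields.YangMills.Theorems.VirialFluxGapQuaternionRadialFlow
import Summits.QuantumFields.YangMills.Theorems.VirialFluxGapRingFrameHessian
import Summits.QuantumFields.YangMills.Theorems.VirialFluxGapCombConstantDeficit
import HarnessLib

/-!
# Route `VirialFluxGap` (YangMills): the RADIAL FLOW OF A COMB-CONSTANT HISTORY — the central zero-mode field on the tree-gauged host `X_fix`
# reproduces the commutator quartic, EXACTLY (twin of ✓`VirialFluxGapConstantHistoryRadialFlow`, weights `(2L², L²)`)

Brick (C1-ii) of the central charts for ⟨stmt-QuantumFields-24141⟩ ON `X_fix` (referee ruling 2026-08-30T23:30Z: the Euler field is hosted on the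
tree-gauged ring space, where the 12 central zero modes are the BLOCK-UNIFORM frame directions — `Y` on the wrap layer `x_k = −1` of direction `k`
on every slice, `Y` on every seam site).  A COMB-CONSTANT ring history (every slice `combFlat h`, constant seam `q`; ✓`CombConstant.ringDeficit_combConst`)
moved by the WRAP-LAYER multi-direction curve (✓`FrameHessian.multiCurve` with `quatMatrix p_k` on the wrap links of direction `k`, `0` on all other
links, `quatMatrix p₄` on every seam site) stays comb-constant (`combConst_mul_multiCurve`: off the wrap layers the curve is `exp(s·0) = 1`), so its
deficit along the curve is LEAD's commutator quartic ✓`ringDeficit_combConst_eq_commutator_quartic` of the moving quaternions, and with RADIAL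
generators `p_k = c_k·Im A_k`, `p₄ = c₄·Im B` (✓`hasDerivAt_su2Quat_mul_expSU`, ✓`hasDerivAt_normSq_comm_radial`):

  ★★★ `hasDerivAt_ringDeficit_combConst_radial` :
  `d/ds|₀ F₀(combConst·γ(s)) = 2L²·Σ_{k<k′} 2(c_k Re A_k + c_{k′} Re A_{k′})·‖[A_k,A_{k′}]‖² + L²·Σ_k 2(c_k Re A_k + c₄ Re B)·‖[A_k,B]‖²`,

★★ `frameD_ringPoly_combConst_radial` — the same number is `frameD Y ringPoly (ringCoord combConst)`.  With `c = ½σ` every quartic term carries the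
factor `σRe + σ′Re′`: `X_z·F₀ = 2F₀` at the central toron, on the comb-constant family, β-free — the (E1) weight count on the `X_fix` host.

* §0 `expSU_congr`, `expSU_of_eq_zero` — dependent rewriting under `expSU` (the wrap-layer assignment is an `if`).

HONEST FRAMING: the 12-dimensional comb-constant family only; transverse directions, chart inequalities and the patching are NOT here; ⟨24141⟩ stays
OPEN; the Yang–Mills mass gap is NOT proved; no summit is proved by a line.  THEOREMS ONLY (0 `def`, 0 `sorry`), standard axioms.  Width seat
`ym-line-sfw-p2-w3` g58 (cell ym-idea-1, free hands), `--supports stmt-QuantumFields-24141`.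
References: [cite: CosteEtAl1985]; [cite: Luscher1983, §2]; [cite: arXiv220412737, §2 (2.4) (p. 10)].
-/

set_option autoImplicit false

noncomputable section

open scoped Matrix ContDiff Topology Quaternion BigOperators
open Literature.MathematicalPhysics.QuantumFieldTheory hiding SU2
open Literature.MathematicalPhysics.QuantumLattice
open Literature.MathematicalPhysics.QuantumFieldTheory.SUNBakryEmery (expSU coe_expSU matTop)

namespace Summit.QuantumFields.YangMills.Theorems.VirialFluxGap.FrameDerivative

open Summit.QuantumFields.YangMills.Theorems.FemtoTransferGap
open Summit.QuantumFields.YangMills.Theorems.FemtoTransferGap.TwoLattice.Flat (combFlat combFlat_apply)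
open Summit.QuantumFields.YangMills.Theorems.VirialFluxGap.RingDeficit
open Summit.QuantumFields.YangMills.Theorems.VirialFluxGap.FrameHessian
open Summit.QuantumFields.YangMills.Theorems.VirialFluxGap.CombConstant

variable {L : ℕ} [NeZero L]

open scoped Matrix.Norms.Frobenius

attribute [local instance 2000] Literature.MathematicalPhysics.QuantumFieldTheory.SUNBakryEmery.matTop

/-! ## §0 Dependent rewriting under `expSU` -/

omit [NeZero L] in
/-- `expSU` depends on the generator only (proof irrelevance). [folklore] -/
theorem expSU_congr {Y Y' : Matrix (Fin 2) (Fin 2) ℂ} (h : Y = Y') (hY : Yᴴ = -Y) (hY0 : Y.trace = 0) (hY' : Y'ᴴ = -Y') (hY0' : Y'.trace = 0)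
    (s : ℝ) : expSU (N := 2) hY hY0 s = expSU (N := 2) hY' hY0' s := by
  subst h; rfl

omit [NeZero L] in
/-- The one-parameter subgroup of the zero generator is constant `1`. [folklore] -/
theorem expSU_of_eq_zero {Y : Matrix (Fin 2) (Fin 2) ℂ} (h : Y = 0) (hY : Yᴴ = -Y) (hY0 : Y.trace = 0) (s : ℝ) :
    expSU (N := 2) hY hY0 s = 1 := by
  apply Subtype.ext
  rw [coe_expSU, h, smul_zero, NormedSpace.exp_zero]; rfl

/-! ## §1 A comb-constant history moved along the wrap layers stays comb-constant -/

omit [NeZero L] in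
/-- ★ **A comb-constant history moved by the wrap-layer multi-direction curve is the comb-constant history of the moved variables**
(off the wrap layers the generator is `0`, so those links stay `1`). [cite: Luscher1983, §2] -/
theorem combConst_mul_multiCurve (h : Fin 3 → SU2) (q : SU2) (p : Fin 3 → ℍ) (p₄ : ℍ)
    (hp : ∀ k, (quatMatrix (p k))ᴴ = -quatMatrix (p k)) (hp0 : ∀ k, (quatMatrix (p k)).trace = 0)
    (hp₄ : (quatMatrix p₄)ᴴ = -quatMatrix p₄) (hp₄0 : (quatMatrix p₄).trace = 0)
    (hY : ∀ w : (Fin (2 * L - 1 + 1) × Edge 3 L) ⊕ Site 3 L,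
      (Sum.elim (fun ie => if ie.2.1 ie.2.2 = -1 then quatMatrix (p ie.2.2) else 0) (fun _ => quatMatrix p₄) w)ᴴ =
        -Sum.elim (fun ie => if ie.2.1 ie.2.2 = -1 then quatMatrix (p ie.2.2) else 0) (fun _ => quatMatrix p₄) w)
    (hY0 : ∀ w : (Fin (2 * L - 1 + 1) × Edge 3 L) ⊕ Site 3 L,
      (Sum.elim (fun ie => if ie.2.1 ie.2.2 = -1 then quatMatrix (p ie.2.2) else 0) (fun _ => quatMatrix p₄) w).trace = 0)
    (s : ℝ) :
    ((fun _ : Fin (2 * L - 1 + 1) => combFlat (L := L) h, fun _ : Site 3 L => q) :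
        (Fin (2 * L - 1 + 1) → GaugeConfig 3 L SU2) × (Site 3 L → SU2)) *
      multiCurve (Sum.elim (fun ie => if ie.2.1 ie.2.2 = -1 then quatMatrix (p ie.2.2) else 0) (fun _ => quatMatrix p₄)) hY hY0 s =
    ((fun _ : Fin (2 * L - 1 + 1) => combFlat (L := L) (fun k => h k * expSU (N := 2) (hp k) (hp0 k) s),
      fun _ : Site 3 L => q * expSU (N := 2) hp₄ hp₄0 s) : (Fin (2 * L - 1 + 1) → GaugeConfig 3 L SU2) × (Site 3 L → SU2)) := by
  unfold multiCurve
  refine Prod.ext ?_ ?_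
  · funext i e
    simp only [Prod.fst_mul, Pi.mul_apply]
    rw [combFlat_apply, combFlat_apply]
    by_cases hx : e.1 e.2 = -1
    · rw [if_pos hx, if_pos hx]
      congr 1
      exact expSU_congr
        (show (if e.1 e.2 = -1 then quatMatrix (p e.2) else 0) = quatMatrix (p e.2) from if_pos hx) _ _ _ _ s
    · rw [if_neg hx, if_neg hx, one_mul]
      exact expSU_of_eq_zero (show (if e.1 e.2 = -1 then quatMatrix (p e.2) else 0) = 0 from if_neg hx) _ _ s
  · funext x
    simp only [Prod.snd_mul, Pi.mul_apply]
    rfl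

/-! ## §2 The deficit of a comb-constant history along the radial flow, and its derivative at `0` -/

/-- ★★★ **The zero-mode radial flow reproduces the commutator quartic on the comb-constant family (host `X_fix`).**  With radial generators
`p_k = c_k·Im(su2Quat h_k)` on the wrap layers and `p₄ = c₄·Im(su2Quat q)` on the seam:
`d/ds|₀ F₀(combConst(h,q)·γ(s)) = 2L²·Σ_{k<k′} 2(c_k Re A_k + c_{k′} Re A_{k′})‖A_kA_{k′} − A_{k′}A_k‖² + L²·Σ_k 2(c_k Re A_k + c₄ Re B)‖A_kB − BA_k‖²`
(`‖·‖² = normSq`). [cite: CosteEtAl1985] -/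
theorem hasDerivAt_ringDeficit_combConst_radial (h : Fin 3 → SU2) (q : SU2) (c : Fin 3 → ℝ) (c₄ : ℝ)
    (hp : ∀ k, (quatMatrix (c k • (su2Quat (h k)).im))ᴴ = -quatMatrix (c k • (su2Quat (h k)).im))
    (hp0 : ∀ k, (quatMatrix (c k • (su2Quat (h k)).im)).trace = 0)
    (hp₄ : (quatMatrix (c₄ • (su2Quat q).im))ᴴ = -quatMatrix (c₄ • (su2Quat q).im)) (hp₄0 : (quatMatrix (c₄ • (su2Quat q).im)).trace = 0)
    (hY : ∀ w : (Fin (2 * L - 1 + 1) × Edge 3 L) ⊕ Site 3 L,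
      (Sum.elim (fun ie => if ie.2.1 ie.2.2 = -1 then quatMatrix (c ie.2.2 • (su2Quat (h ie.2.2)).im) else 0)
          (fun _ => quatMatrix (c₄ • (su2Quat q).im)) w)ᴴ =
        -Sum.elim (fun ie => if ie.2.1 ie.2.2 = -1 then quatMatrix (c ie.2.2 • (su2Quat (h ie.2.2)).im) else 0)
          (fun _ => quatMatrix (c₄ • (su2Quat q).im)) w)
    (hY0 : ∀ w : (Fin (2 * L - 1 + 1) × Edge 3 L) ⊕ Site 3 L,
      (Sum.elim (fun ie => if ie.2.1 ie.2.2 = -1 then quatMatrix (c ie.2.2 • (su2Quat (h ie.2.2)).im) else 0)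
          (fun _ => quatMatrix (c₄ • (su2Quat q).im)) w).trace = 0) :
    HasDerivAt (fun s : ℝ => ringDeficit L (fun _ => false)
        ((((fun _ : Fin (2 * L - 1 + 1) => combFlat (L := L) h, fun _ : Site 3 L => q) :
            (Fin (2 * L - 1 + 1) → GaugeConfig 3 L SU2) × (Site 3 L → SU2)) *
          multiCurve (Sum.elim (fun ie => if ie.2.1 ie.2.2 = -1 then quatMatrix (c ie.2.2 • (su2Quat (h ie.2.2)).im) else 0)
            (fun _ => quatMatrix (c₄ • (su2Quat q).im))) hY hY0 s)))
      (2 * (L : ℝ) ^ 2 * ∑ pr : {pr : Fin 3 × Fin 3 // pr.1 < pr.2},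
          2 * (c pr.1.1 * (su2Quat (h pr.1.1)).re + c pr.1.2 * (su2Quat (h pr.1.2)).re) *
            Quaternion.normSq (su2Quat (h pr.1.1) * su2Quat (h pr.1.2) - su2Quat (h pr.1.2) * su2Quat (h pr.1.1)) +
        (L : ℝ) ^ 2 * ∑ k : Fin 3, 2 * (c k * (su2Quat (h k)).re + c₄ * (su2Quat q).re) *
            Quaternion.normSq (su2Quat (h k) * su2Quat q - su2Quat q * su2Quat (h k))) 0 := by
  -- the moving quaternions and their radial derivatives at `s = 0`
  set A : Fin 3 → ℝ → ℍ := fun k s => su2Quat (h k * expSU (N := 2) (hp k) (hp0 k) s) with hA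
  set B : ℝ → ℍ := fun s => su2Quat (q * expSU (N := 2) hp₄ hp₄0 s) with hB
  have hA0 : ∀ k, A k 0 = su2Quat (h k) := fun k => by simp only [hA, FrameDerivative.expSU_zero, mul_one]
  have hB0 : B 0 = su2Quat q := by simp only [hB, FrameDerivative.expSU_zero, mul_one]
  have hAd : ∀ k, HasDerivAt (A k) (c k • (A k 0 * (A k 0).im)) 0 := fun k => by
    have hd := hasDerivAt_su2Quat_mul_expSU (h k) (c k • (su2Quat (h k)).im) (hp k) (hp0 k) 0
    rw [hA0]
    refine hd.congr_deriv ?_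
    rw [FrameDerivative.expSU_zero, mul_one, mul_smul_comm]
  have hBd : HasDerivAt B (c₄ • (B 0 * (B 0).im)) 0 := by
    have hd := hasDerivAt_su2Quat_mul_expSU q (c₄ • (su2Quat q).im) hp₄ hp₄0 0
    rw [hB0]
    refine hd.congr_deriv ?_
    rw [FrameDerivative.expSU_zero, mul_one, mul_smul_comm]
  -- the deficit along the curve is the commutator quartic of the moving quaternions
  have heq : (fun s : ℝ => ringDeficit L (fun _ => false)
        ((((fun _ : Fin (2 * L - 1 + 1) => combFlat (L := L) h, fun _ : Site 3 L => q) :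
            (Fin (2 * L - 1 + 1) → GaugeConfig 3 L SU2) × (Site 3 L → SU2)) *
          multiCurve (Sum.elim (fun ie => if ie.2.1 ie.2.2 = -1 then quatMatrix (c ie.2.2 • (su2Quat (h ie.2.2)).im) else 0)
            (fun _ => quatMatrix (c₄ • (su2Quat q).im))) hY hY0 s))) =
      fun s => 2 * (L : ℝ) ^ 2 * ∑ pr : {pr : Fin 3 × Fin 3 // pr.1 < pr.2},
          Quaternion.normSq (A pr.1.1 s * A pr.1.2 s - A pr.1.2 s * A pr.1.1 s) +
        (L : ℝ) ^ 2 * ∑ k : Fin 3, Quaternion.normSq (A k s * B s - B s * A k s) := by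
    funext s
    rw [combConst_mul_multiCurve h q (fun k => c k • (su2Quat (h k)).im) (c₄ • (su2Quat q).im) hp hp0 hp₄ hp₄0 hY hY0 s]
    have hc := ringDeficit_combConst_eq_commutator_quartic (L := L) (fun k => h k * expSU (N := 2) (hp k) (hp0 k) s)
      (q * expSU (N := 2) hp₄ hp₄0 s)
    rw [hc]
    simp only [hA, hB, Quaternion.normSq_eq_norm_mul_self, sq]
  rw [heq]
  -- differentiate term by term
  have hpair : ∀ pr : {pr : Fin 3 × Fin 3 // pr.1 < pr.2},
      HasDerivAt (fun s => Quaternion.normSq (A pr.1.1 s * A pr.1.2 s - A pr.1.2 s * A pr.1.1 s))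
        (2 * (c pr.1.1 * (su2Quat (h pr.1.1)).re + c pr.1.2 * (su2Quat (h pr.1.2)).re) *
          Quaternion.normSq (su2Quat (h pr.1.1) * su2Quat (h pr.1.2) - su2Quat (h pr.1.2) * su2Quat (h pr.1.1))) 0 := fun pr => by
    have hd := hasDerivAt_normSq_comm_radial (hAd pr.1.1) (hAd pr.1.2)
    simpa only [hA0] using hd
  have hseam : ∀ k : Fin 3, HasDerivAt (fun s => Quaternion.normSq (A k s * B s - B s * A k s))
      (2 * (c k * (su2Quat (h k)).re + c₄ * (su2Quat q).re) * Quaternion.normSq (su2Quat (h k) * su2Quat q - su2Quat q * su2Quat (h k))) 0 :=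
    fun k => by
    have hd := hasDerivAt_normSq_comm_radial (hAd k) hBd
    simpa only [hA0, hB0] using hd
  exact ((HasDerivAt.fun_sum fun pr _ => hpair pr).const_mul _).add ((HasDerivAt.fun_sum fun k _ => hseam k).const_mul _)

/-- ★★ **The frame form on the `X_fix` host**: the number of `hasDerivAt_ringDeficit_combConst_radial` IS the multi-direction frame derivative
`frameD Y ringPoly (ringCoord combConst)` of ✓`FrameHessian` (uniqueness of derivatives). [cite: arXiv220412737, §2 (2.4) (p. 10)] -/
theorem frameD_ringPoly_combConst_radial (h : Fin 3 → SU2) (q : SU2) (c : Fin 3 → ℝ) (c₄ : ℝ)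
    (hp : ∀ k, (quatMatrix (c k • (su2Quat (h k)).im))ᴴ = -quatMatrix (c k • (su2Quat (h k)).im))
    (hp0 : ∀ k, (quatMatrix (c k • (su2Quat (h k)).im)).trace = 0)
    (hp₄ : (quatMatrix (c₄ • (su2Quat q).im))ᴴ = -quatMatrix (c₄ • (su2Quat q).im)) (hp₄0 : (quatMatrix (c₄ • (su2Quat q).im)).trace = 0)
    (hY : ∀ w : (Fin (2 * L - 1 + 1) × Edge 3 L) ⊕ Site 3 L,
      (Sum.elim (fun ie => if ie.2.1 ie.2.2 = -1 then quatMatrix (c ie.2.2 • (su2Quat (h ie.2.2)).im) else 0)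
          (fun _ => quatMatrix (c₄ • (su2Quat q).im)) w)ᴴ =
        -Sum.elim (fun ie => if ie.2.1 ie.2.2 = -1 then quatMatrix (c ie.2.2 • (su2Quat (h ie.2.2)).im) else 0)
          (fun _ => quatMatrix (c₄ • (su2Quat q).im)) w)
    (hY0 : ∀ w : (Fin (2 * L - 1 + 1) × Edge 3 L) ⊕ Site 3 L,
      (Sum.elim (fun ie => if ie.2.1 ie.2.2 = -1 then quatMatrix (c ie.2.2 • (su2Quat (h ie.2.2)).im) else 0)
          (fun _ => quatMatrix (c₄ • (su2Quat q).im)) w).trace = 0) :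
    frameD (Sum.elim (fun ie => if ie.2.1 ie.2.2 = -1 then quatMatrix (c ie.2.2 • (su2Quat (h ie.2.2)).im) else 0)
        (fun _ => quatMatrix (c₄ • (su2Quat q).im))) (ringPoly L)
        (ringCoord L (((fun _ : Fin (2 * L - 1 + 1) => combFlat (L := L) h, fun _ : Site 3 L => q) :
          (Fin (2 * L - 1 + 1) → GaugeConfig 3 L SU2) × (Site 3 L → SU2)))) =
      2 * (L : ℝ) ^ 2 * ∑ pr : {pr : Fin 3 × Fin 3 // pr.1 < pr.2},
          2 * (c pr.1.1 * (su2Quat (h pr.1.1)).re + c pr.1.2 * (su2Quat (h pr.1.2)).re) *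
            Quaternion.normSq (su2Quat (h pr.1.1) * su2Quat (h pr.1.2) - su2Quat (h pr.1.2) * su2Quat (h pr.1.1)) +
        (L : ℝ) ^ 2 * ∑ k : Fin 3, 2 * (c k * (su2Quat (h k)).re + c₄ * (su2Quat q).re) *
            Quaternion.normSq (su2Quat (h k) * su2Quat q - su2Quat q * su2Quat (h k)) := by
  have h1 := hasDerivAt_ringDeficit_multiCurve
    (Sum.elim (fun ie => if ie.2.1 ie.2.2 = -1 then quatMatrix (c ie.2.2 • (su2Quat (h ie.2.2)).im) else 0)
      (fun _ => quatMatrix (c₄ • (su2Quat q).im))) hY hY0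
    (((fun _ : Fin (2 * L - 1 + 1) => combFlat (L := L) h, fun _ : Site 3 L => q) :
      (Fin (2 * L - 1 + 1) → GaugeConfig 3 L SU2) × (Site 3 L → SU2))) 0
  rw [multiCurve_zero, mul_one] at h1
  exact h1.unique (hasDerivAt_ringDeficit_combConst_radial h q c c₄ hp hp0 hp₄ hp₄0 hY hY0)

end Summit.QuantumFields.YangMills.Theorems.VirialFluxGap.FrameDerivative

end
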